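import Literature.AlgebraicTopology.SingularHomology.WuClasses
import Literature.AlgebraicTopology.SingularHomology.RelFundamentalClassModTwo
import Mathlib.LinearAlgebra.Dual.Lemmas
import HarnessLib

/-!
# Wu classes of a boundary come from the bounding manifold; Wu numbers of a boundary vanish

L. S. Pontryagin, *Characteristic cycles on differentiable manifolds*, Mat. Sb. 21 (63) (1947)
(Thm.: the Stiefel–Whitney numbers of a bounding manifold vanish); R. Thom, *Quelques propriétés
globales des variétés différentiables*, Comment. Math. Helv. 28 (1954), Thm. IV.3 (p. 66): "si deux
variétés sont cobordantes mod 2, leurs nombres caractéristiques de Stiefel–Whitney sont égaux";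
J. W. Milnor, J. D. Stasheff, *Characteristic Classes* (1974), Thm. 4.9 (p. 52) with the proof:
for `B = ∂W`, `i : B → W`, every characteristic class of `B` is `i^*` of a class of `W`, and
`⟨i^* a, μ_B⟩ = ⟨a, i_* μ_B⟩ = ⟨a, i_* ∂ μ_W⟩ = 0`.

This file PROVES the Wu-class form of that argument for the tree's singular (co)homology with
`ℤ/2` coefficients — no tangent bundle and no Stiefel–Whitney classes are needed (by Wu's formula
`w = Sq(v)` the Stiefel–Whitney classes are polynomials in Steenrod squares of Wu classes, so the
printed theorem follows from the statements below together with the naturality of `Sqⁱ`; that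
translation is NOT made here). For `W : Type u` a compact Hausdorff space charted on
`EuclideanHalfSpace (n + 1)` (`n ≠ 0`), `B = ↥(∂W)` its boundary — a closed topological `n`-manifold
(`boundaryTopChartedSpace`, `BoundaryInvariance.lean`) — and `i : B → W` the inclusion:

* `wuClass_boundary_mem_range` — **`v_k(∂W) ∈ im (i^* : Hᵏ(W; ℤ/2) → Hᵏ(∂W; ℤ/2))`** for every
  `k`.  Proof (all ingredients proved in the tree): with `z = [W, ∂W]₂`
  (`relFundamentalClassModTwo`) and `[∂W]₂ = ∂z` (`fundamentalClass_boundary_eq_δ_…`), for every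
  `c ∈ Hⁿ⁻ᵏ(W)`, `⟨c, i_*(v_k ⌢ [∂W]₂)⟩ = ⟨v_k ⌣ i^*c, [∂W]₂⟩ = ⟨Sqᵏ i^*c, [∂W]₂⟩ = ⟨Sqᵏ c, i_* ∂z⟩ = 0`,
  so `i_*(v_k ⌢ [∂W]₂) = 0` (the Kronecker map is onto over a field, and linear forms separate
  points); by exactness `v_k ⌢ ∂z ∈ im ∂ = (im i^*) ⌢ ∂z` (Lefschetz duality mod 2 and the boundary
  formula `∂(a ⌢ z) = ± i^*a ⌢ ∂z`, `map_range_cohomologyMap_eq_range_δ`), and Poincaré duality on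
  `∂W` cancels `⌢ [∂W]₂`;
* `kroneckerPairing_modTwoFundamentalClass_boundary_eq_zero` — **a top-degree class of `∂W` in
  the image of `i^*` has Kronecker product `0` with `[∂W]₂`** (`⟨i^*a, ∂z⟩ = ⟨a, i_*∂z⟩ = 0`);
* `cupProduct_mem_range_map`, `steenrodSqLower_mem_range_map` — the image of `i^*` is closed under
  cup products and Steenrod squares (naturality);

hence every monomial in (Steenrod squares of) Wu classes of total degree `n` pairs to zero with
`[∂W]₂` — the Wu/Stiefel–Whitney NUMBERS of a boundary vanish; the degree-`4` instance
`⟨v₁⁴, [∂W]₂⟩ = 0` used for `𝔑₄` is `kroneckerPairing_wuClass_one_pow_four_boundary`. No named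
facts are introduced. Written in support of
`Literature.Topology.FourManifolds.natCard_unorientedBordismClass_four` (Thom 1954, Thm. IV.9 at `k = 4`).

## References

* R. Thom, *Quelques propriétés globales des variétés différentiables*, Comment. Math. Helv. 28
  (1954), 17–86, Thm. IV.3 (p. 66). [ThomCMH1954]
* J. W. Milnor, J. D. Stasheff, *Characteristic Classes*, Ann. of Math. Studies 76, Princeton
  1974, §4 Thm. 4.9 (Pontryagin), §11 p. 132 (Wu classes). [MilnorStasheff1974]
* A. Hatcher, *Algebraic Topology*, CUP 2002, §3.3 Thm. 3.43 and p. 254 (the duality ladder).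
  [HatcherAT2002]
-/

noncomputable section

open CategoryTheory Set Function
open scoped Manifold

universe u

namespace Literature.AlgebraicTopology.SingularHomology

/-! ### Generalities: linear forms detect classes over a field; images of `f^*` are subalgebras -/

section General

variable {F : Type} [Field F] {X Y : Type u} [TopologicalSpace X] [TopologicalSpace Y]

/-- Over a field, a homology class on which every cohomology class evaluates to zero is zero
(Hatcher 2002, §3.1 Thm. 3.2 over a field: the Kronecker map `Hⁿ → Hom(Hₙ, F)` is onto, and linear
forms separate the points of a vector space). [cite: HatcherAT2002, §3.1 Thm. 3.2 (p. 198)] -/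
theorem singularHomology.eq_zero_of_forall_kroneckerPairing_eq_zero {n : ℕ}
    {x : singularHomology F F X n} (h : ∀ c : singularCohomology F F X n, kroneckerPairing F F X n c x = 0) :
    x = 0 := by
  refine (Module.forall_dual_apply_eq_zero_iff F x).1 fun φ => ?_
  obtain ⟨c, rfl⟩ := (kroneckerPairing_bijective_of_field F X n).2 φ
  exact h c

variable {R : Type} [CommRing R]

/-- The image of `f^*` is closed under cup products (`f^*a ⌣ f^*b = f^*(a ⌣ b)`, Hatcher 2002,
Prop. 3.10). [cite: HatcherAT2002, §3.2 Prop. 3.10] -/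
theorem cupProduct_mem_range_map (f : C(X, Y)) {p q n : ℕ} (h : p + q = n)
    {a : singularCohomology R R X p} {b : singularCohomology R R X q}
    (ha : a ∈ LinearMap.range (singularCohomology.map R R f p).hom)
    (hb : b ∈ LinearMap.range (singularCohomology.map R R f q).hom) :
    cupProduct h a b ∈ LinearMap.range (singularCohomology.map R R f n).hom := by
  obtain ⟨a, rfl⟩ := ha
  obtain ⟨b, rfl⟩ := hb
  exact ⟨cupProduct h a b, cupProduct_map f h a b⟩

/-- The image of `f^*` is closed under the Steenrod squares (naturality, Steenrod 1947 §7), `R`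
of characteristic two. [cite: MilnorStasheff1974, §8 (naturality of Sq)] -/
theorem steenrodSqLower_mem_range_map [CharP R 2] (f : C(X, Y)) {p : ℕ} (n i : ℕ)
    {a : singularCohomology R R X p} (ha : a ∈ LinearMap.range (singularCohomology.map R R f p).hom) :
    steenrodSqLower X p n i a ∈ LinearMap.range (singularCohomology.map R R f n).hom := by
  obtain ⟨a, rfl⟩ := ha
  exact ⟨steenrodSqLower Y p n i a, steenrodSqLower_map f n i a⟩

end General

/-! ### The boundary of a compact manifold with boundary -/

section Boundary

variable {n : ℕ} {W : Type u} [TopologicalSpace W] [T2Space W] [CompactSpace W]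
  [ChartedSpace (EuclideanHalfSpace (n + 1)) W]

attribute [local instance] boundaryTopChartedSpace

/-- The boundary of a compact manifold with boundary is compact (it is closed,
`isCompact_boundary`). [cite: HatcherAT2002, §3.3 p. 252] -/
theorem compactSpace_boundary : CompactSpace ↥((𝓡∂ (n + 1)).boundary W) :=
  isCompact_iff_compactSpace.1 isCompact_boundary

attribute [local instance] compactSpace_boundary

/-- **`[∂W]₂ = ∂[W, ∂W]₂`** for the mod-2 fundamental class `[∂W]₂ = modTwoFundamentalClass` of the
closed `n`-manifold `∂W` (`n ≠ 0`; Spanier Cor. 6.3.10, via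
`fundamentalClass_boundary_eq_δ_relFundamentalClassModTwo`). [cite: Spanier1981, Ch. 6 Sec. 3 Cor. 10] -/
theorem modTwoFundamentalClass_boundary_eq_δ (hn : n ≠ 0) :
    modTwoFundamentalClass ↥((𝓡∂ (n + 1)).boundary W) n =
      relativeSingularHomology.δ (ZMod 2) (ZMod 2) W ((𝓡∂ (n + 1)).boundary W) n
        (relFundamentalClassModTwo n W) :=
  fundamentalClass_boundary_eq_δ_relFundamentalClassModTwo hn _

/-- **`i_* [∂W]₂ = 0`** in `Hₙ(W; ℤ/2)` (`i_* ∘ ∂ = 0` in the exact sequence of the pair).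
[cite: HatcherAT2002, §2.1 (long exact sequence of the pair)] -/
theorem map_modTwoFundamentalClass_boundary_eq_zero (hn : n ≠ 0) :
    singularHomology.map (ZMod 2) (ZMod 2)
      (⟨Subtype.val, continuous_subtype_val⟩ : C(↥((𝓡∂ (n + 1)).boundary W), W)) n
      (modTwoFundamentalClass ↥((𝓡∂ (n + 1)).boundary W) n) = 0 := by
  rw [modTwoFundamentalClass_boundary_eq_δ hn, ← ModuleCat.comp_apply,
    relativeSingularHomology.δ_comp_map]
  rfl

/-- **A top-degree class of `∂W` coming from `W` has Kronecker product zero with `[∂W]₂`**: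
`⟨i^*a, [∂W]₂⟩ = ⟨a, i_*[∂W]₂⟩ = 0` (Milnor–Stasheff 1974, proof of Thm. 4.9).
[cite: MilnorStasheff1974, §4 Thm. 4.9 (proof)] -/
theorem kroneckerPairing_modTwoFundamentalClass_boundary_eq_zero (hn : n ≠ 0)
    {c : singularCohomology (ZMod 2) (ZMod 2) ↥((𝓡∂ (n + 1)).boundary W) n}
    (hc : c ∈ LinearMap.range (singularCohomology.map (ZMod 2) (ZMod 2)
      (⟨Subtype.val, continuous_subtype_val⟩ : C(↥((𝓡∂ (n + 1)).boundary W), W)) n).hom) :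
    kroneckerPairing (ZMod 2) (ZMod 2) _ n c (modTwoFundamentalClass ↥((𝓡∂ (n + 1)).boundary W) n) = 0 := by
  obtain ⟨a, rfl⟩ := hc
  change kroneckerPairing (ZMod 2) (ZMod 2) _ n (singularCohomology.map (ZMod 2) (ZMod 2) _ n a) _ = 0
  rw [kroneckerPairing_map, map_modTwoFundamentalClass_boundary_eq_zero hn, map_zero]

/-- **The Wu classes of a boundary come from the bounding manifold**: for a compact topological
`(n+1)`-manifold with boundary `W` (`n ≠ 0`) and every `k`,
`v_k(∂W) ∈ im (i^* : Hᵏ(W; ℤ/2) → Hᵏ(∂W; ℤ/2))` — the Wu-class form of the key step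
"`w(B) = i^* w(W)`" in Pontryagin's theorem (Milnor–Stasheff 1974, proof of Thm. 4.9; Thom 1954,
Thm. IV.3). Ingredients: Lefschetz duality mod 2 (`bijective_relCapProduct_relFundamentalClassModTwo`),
the duality ladder `(im i^*) ⌢ ∂z = im ∂` (`map_range_cohomologyMap_eq_range_δ`), exactness
`im ∂ = ker i_*`, the Wu identity `⟨v_k ⌣ y, [∂W]₂⟩ = ⟨Sqᵏ y, [∂W]₂⟩` with naturality of `Sqᵏ`, and
Poincaré duality mod 2 on `∂W`. [cite: MilnorStasheff1974, §4 Thm. 4.9 (proof)] [cite: ThomCMH1954, Thm. IV.3] -/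
theorem wuClass_boundary_mem_range (hn : n ≠ 0) (k : ℕ) :
    wuClass ↥((𝓡∂ (n + 1)).boundary W) n k ∈
      LinearMap.range (singularCohomology.map (ZMod 2) (ZMod 2)
        (⟨Subtype.val, continuous_subtype_val⟩ : C(↥((𝓡∂ (n + 1)).boundary W), W)) k).hom := by
  haveI : Fact (Nat.Prime 2) := ⟨Nat.prime_two⟩
  set B : Set W := (𝓡∂ (n + 1)).boundary W with hBdef
  set ι : C(↥B, W) := ⟨Subtype.val, continuous_subtype_val⟩ with hι
  by_cases hkn : k ≤ n
  swap
  · rw [wuClass_eq_zero_of_lt' (not_le.1 hkn)]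
    exact zero_mem _
  obtain ⟨p, hp⟩ : ∃ p, p = n - k := ⟨_, rfl⟩
  have h : k + p = n := by omega
  set z := relFundamentalClassModTwo n W with hzdef
  have hB : modTwoFundamentalClass (↥B) n = relativeSingularHomology.δ (ZMod 2) (ZMod 2) W B n z :=
    modTwoFundamentalClass_boundary_eq_δ hn
  -- Step 1: `i_* (v_k ⌢ [∂W]₂) = 0`, tested against every `c ∈ Hᵖ(W; ℤ/2)`
  have h1 : singularHomology.map (ZMod 2) (ZMod 2) ι p
      (capProduct h (wuClass (↥B) n k) (modTwoFundamentalClass (↥B) n)) = 0 := by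
    refine singularHomology.eq_zero_of_forall_kroneckerPairing_eq_zero fun c => ?_
    rw [← kroneckerPairing_map, ← kroneckerPairing_cupProduct h, kroneckerPairing_wuClass_cupProduct h,
      ← steenrodSqLower_map ι, kroneckerPairing_map, map_modTwoFundamentalClass_boundary_eq_zero hn,
      map_zero]
  -- Step 2: `v_k ⌢ ∂z ∈ ker i_* = im ∂ = (im i^*) ⌢ ∂z`
  have hL : Function.Surjective fun a : singularCohomology (ZMod 2) (ZMod 2) W k =>
      relCapProduct (M := ZMod 2) B (show k + (p + 1) = n + 1 by omega) a z :=
    (bijective_relCapProduct_relFundamentalClassModTwo (n := n) (W := W)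
      (show k + (p + 1) = n + 1 by omega)).2
  have e1 := map_range_cohomologyMap_eq_range_δ (M := ZMod 2) z h hL
  have e2 : LinearMap.range (relativeSingularHomology.δ (ZMod 2) (ZMod 2) W B p).hom =
      LinearMap.ker (singularHomology.map (ZMod 2) (ZMod 2) ι p).hom :=
    (relativeSingularHomology.exact_δ_map (ZMod 2) (ZMod 2) B p).moduleCat_range_eq_ker
  have hmem : capProduct h (wuClass (↥B) n k) (relativeSingularHomology.δ (ZMod 2) (ZMod 2) W B n z) ∈
      LinearMap.ker (singularHomology.map (ZMod 2) (ZMod 2) ι p).hom := by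
    rw [LinearMap.mem_ker, ← hB]
    exact h1
  rw [← e2, ← e1] at hmem
  obtain ⟨b, ⟨a, rfl⟩, hb⟩ := hmem
  -- Step 3: Poincaré duality on `∂W` cancels `⌢ [∂W]₂`
  refine ⟨a, (poincare_duality (modTwoOrientation (↥B) n) h).1 ?_⟩
  rw [poincareDualityMap_apply, poincareDualityMap_apply]
  change capProduct h _ (modTwoFundamentalClass (↥B) n) = capProduct h _ (modTwoFundamentalClass (↥B) n)
  rw [hB]
  exact hb

/-- **`⟨v₁⁴, [∂W]₂⟩ = 0` for the boundary of a compact `5`-manifold with boundary** — the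
Wu-number instance of Pontryagin's theorem used for `𝔑₄` (Thom 1954, Thm. IV.3 with IV.9/IV.12:
the number `w₁⁴ = v₁⁴` of a mod-2 boundary vanishes). [cite: ThomCMH1954, Thm. IV.3] [cite: MilnorStasheff1974, §4 Thm. 4.9] -/
theorem kroneckerPairing_wuClass_one_pow_four_boundary {W : Type u} [TopologicalSpace W] [T2Space W]
    [CompactSpace W] [ChartedSpace (EuclideanHalfSpace (4 + 1)) W] :
    kroneckerPairing (ZMod 2) (ZMod 2) ↥((𝓡∂ (4 + 1)).boundary W) 4
      (cupProduct (show 2 + 2 = 4 by rfl)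
        (cupProduct (show 1 + 1 = 2 by rfl) (wuClass ↥((𝓡∂ (4 + 1)).boundary W) 4 1)
          (wuClass ↥((𝓡∂ (4 + 1)).boundary W) 4 1))
        (cupProduct (show 1 + 1 = 2 by rfl) (wuClass ↥((𝓡∂ (4 + 1)).boundary W) 4 1)
          (wuClass ↥((𝓡∂ (4 + 1)).boundary W) 4 1)))
      (modTwoFundamentalClass ↥((𝓡∂ (4 + 1)).boundary W) 4) = 0 := by
  have hv := wuClass_boundary_mem_range (n := 4) (W := W) (by norm_num) 1
  exact kroneckerPairing_modTwoFundamentalClass_boundary_eq_zero (by norm_num)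
    (cupProduct_mem_range_map _ _ (cupProduct_mem_range_map _ _ hv hv) (cupProduct_mem_range_map _ _ hv hv))

end Boundary

end Literature.AlgebraicTopology.SingularHomology
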